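import Literature.MathematicalPhysics.QuantumFieldTheory.BalabanImbrieJaffe1984to88.BIJ88Ineq5144OneCube
import Literature.MathematicalPhysics.QuantumFieldTheory.BalabanImbrieJaffe1984to88.BIJ88CutoffProfileWitness
import Literature.MathematicalPhysics.QuantumFieldTheory.BalabanImbrieJaffe1984to88.BIJ88SmallChargeRegime

/-!
# `BalabanImbrieJaffe1984to88.BIJ88Ineq5144OneCubeInstance` — T. Bałaban, J. Imbrie, A. Jaffe, *Effective action and cluster properties of the
abelian Higgs model*, Commun. Math. Phys. **114** (1988) 257–315 [BalabanImbrieJaffe1988], Sect. 5.14, (5.14.4) p. 309 [PDF 53]: **A KERNEL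
CERTIFICATE THAT THE HYPOTHESIS FAMILY OF THE ONE-CUBE THEOREM `BIJ88Ineq5144OneCube.ineq5144_locAct_singleton_of_const` / `…_uniform` IS
JOINTLY SATISFIABLE** — the theorem INSTANTIATED on a concrete datum, all its hypotheses discharged, for every sufficiently small charge `e_k`.

statement-level skeleton of published theorems with citation tags; proofs where landed; nothing here is a claim about the Yang–Mills mass gap

THE DATUM: one site and one cube (types `Unit`), precision `Δ = 1`, source `ℱ = 0`, ONE χ-slot whose slot field is the site field itself (a
linear functional), threshold `c = 1`, no interaction terms, the profile `χ = gevreyCutoff` of this seat's `BIJ88CutoffProfileWitness` (`χ ≥ 0`);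
the tail constants of gen 13's `BIJ88GaussShellModulus309.tail_slotField_fieldLaw_of_mod` under the one-site law (`A = 4e^{0}`, `κ = 1/(8v)` with
`v = 1 + Var`, mean `0` by gen 12's `BIJ88EffectiveActionGauss308.integral_slotField_fieldLaw` since `ℱ = 0`), one slot per cube, `θ = √e_k`,
`β′ = 1`.  With the all-orders constant `Ĉ = Ĉ(χ, p, n₀)` chosen FIRST, the five regime inequalities (`n₀ + 1 ≤ κ(81/100)|log e_k⁻¹|^{2p−1}`,
`e_k ≤ e⁻¹`, `Ĉ^{n₀}·4·e_k ≤ 1`, `4e_k ≤ √e_k`, `e_k ≤ 1`) hold for all `e_k` below a threshold `e₀ > 0`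
(`BIJ88SmallChargeRegime.exists_threshold`), and the theorem yields `|g₃(H, X₁)| ≤ (√e_k)^{|H| + |X₁ ∖ loc(H)|}` on every one-cube polymer `X₁`,
for every corner, region, `t ∈ (0,1]`, `|L| ≤ n₀`, assignment and label set — **`ineq5144_locAct_singleton_instance`** (one theorem; 0 definitions,
0 `Prop` facts).  (Cf. gen 14's `BIJ88Eq5145LocatedInstance` for the located C2.Eq5.14.5 head: the cell's flip criterion «hypotheses jointly
satisfiable», GAPS G-C2-p36-07.)
HONEST SCOPE: a degenerate but legal datum; a satisfiability certificate for the quantifier structure of the one-cube theorem, not a step of the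
paper's proof.  PDF held: `paper:balaban1988-cmp114-bij-abelian-higgs-effective-action` (journal page = PDF page + 256); p. 309 = PDF 53 read this
generation.  0 `sorry`, 0 definitions, 0 `Prop` facts (D-0026); imports `BIJ88Ineq5144OneCube` (p36 g15, v1.1), `BIJ88CutoffProfileWitness`
(p36 g7), `BIJ88SmallChargeRegime` (p36 g6).  NOT summit progress; NOT continuum; NOT Clay.  Cell `lit-balaban` Phase 2, seat p36 gen 15 (row
C2.Eq5.14.3-5.14.4 member cell, owner r16, referee ref-5).
-/

noncomputable section

open Finset MeasureTheory ProbabilityTheory Filter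
open Literature.MathematicalPhysics.QuantumFieldTheory.BalabanImbrieJaffe1984to88
open BIJ88Sect2Statements (pLog)
open BIJ88Sect5Statements (CutoffProfile cutoff)
open BIJ88GaussIntegration309Product (exists_const_all_orders)
open BIJ88PolymerRep5134Gauss (ext prec)
open BIJ88PolymerRep5134 (corner)
open BIJ88SlotMomentsGauss308 (fieldLaw)
open BIJ88Eq5145CornerModel (slotB slotY prec_corner_posDef)
open BIJ88Eq5145CornerUrsell (cubeIn)
open BIJ88W6PrimeVsupp (actIn)
open BIJ88Ineq5144Located (locAct)
open BIJ88CutoffProfileWitness (gevreyCutoff chi1_nonneg)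
open BIJ88SmallChargeRegime (exists_threshold eventually_const_le_mul_log_rpow eventually_const_mul_le_one eventually_le_one)
open BIJ88Ineq5144OneCube (ineq5144_locAct_singleton_of_const)

namespace Literature.MathematicalPhysics.QuantumFieldTheory.BalabanImbrieJaffe1984to88.BIJ88Ineq5144OneCubeInstance

/-- **NON-VACUITY CERTIFICATE for `BIJ88Ineq5144OneCube.ineq5144_locAct_singleton_of_const` / `…_uniform`**: on the concrete one-site,
one-cube, one-χ-slot datum (site type `Unit`, cube map constant, `Δ = 1`, `ℱ = 0`, χ-slot field = the site field itself (linear), threshold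
`c = 1`, no interaction terms, profile `χ = gevreyCutoff` of `BIJ88CutoffProfileWitness`), EVERY hypothesis of the one-cube theorem is met for all
sufficiently small charges `e_k` — with the tail constants of `BIJ88GaussShellModulus309.tail_slotField_fieldLaw_of_mod` (`A = 4`, `κ = 1/(8v)`,
`v = 1 + Var`), `θ = √e_k`, `β′ = 1` —, so its conclusion holds there: `|g₃| ≤ (√e_k)^{|H| + |X₁ ∖ loc(H)|}` on every one-cube polymer.  The
threshold `e₀` depends on `p`, `n₀` (through the all-orders constant `Ĉ`) and on the datum only. [cite: BalabanImbrieJaffe1988, (5.14.4) p.309] -/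
theorem ineq5144_locAct_singleton_instance (adj : Unit → Unit → Prop) [DecidableRel adj] {p : ℝ} (hp : 1 / 2 < p) (n₀ : ℕ) :
    ∃ e₀ : ℝ, 0 < e₀ ∧ ∀ ⦃e : ℝ⦄, 0 < e → e < e₀ →
      ∀ (Λ X : Finset Unit) {t : ℝ} (_ : t ∈ Set.Ioc (0 : ℝ) 1) {L : Type} [Fintype L] [DecidableEq L] (_ : Fintype.card L ≤ n₀)
        (γ : L → ↥(slotB ({()} : Finset Unit) (∅ : Finset Unit) (fun _ => ()) X) ⊕
          ↥(slotY ({()} : Finset Unit) (∅ : Finset Unit) (fun _ => ()) X))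
        (H : Finset L) (X₁ : Finset Unit) (_ : X₁.card = 1),
        |locAct (cubeIn (fun _ => ()) X ∘ γ)
            (actIn (fun _ : Unit => ()) (1 : Matrix Unit Unit ℝ) (0 : Unit → ℝ) adj gevreyCutoff p e ({()} : Finset Unit)
              (fun (_ : Unit) (φ : Unit → ℝ) => φ ()) (fun _ => (1 : ℝ)) (∅ : Finset Unit) (fun (_ : Unit) (_ : Unit → ℝ) => (0 : ℝ))
              (fun _ => ()) Λ X t γ) H X₁| ≤
          Real.sqrt e ^ ((H.card : ℝ) + 1 * ((X₁ \ H.image (cubeIn (fun _ => ()) X ∘ γ)).card : ℝ)) := by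
  classical
  obtain ⟨C, hC1, hC⟩ := exists_const_all_orders gevreyCutoff p n₀
  -- the one-site law of the single cube and the variance scale of its slot field
  set P₀ : Measure ({x : Unit // (fun _ : Unit => ()) x ∈ ({()} : Finset Unit)} → ℝ) :=
    fieldLaw (fun _ : Unit => ()) (1 : Matrix Unit Unit ℝ) (0 : Unit → ℝ) ({()} : Finset Unit) with hP₀
  set v : ℝ := 1 + Var[fun ω => (ext (fun _ : Unit => ()) ({()} : Finset Unit) ω) (); P₀] with hv
  have hv0 : 0 < v := by
    have := variance_nonneg (fun ω => (ext (fun _ : Unit => ()) ({()} : Finset Unit) ω) ()) P₀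
    rw [hv]; linarith
  have hκ0 : 0 < 1 / (8 * v) * (81 / 100) * (1 : ℝ) ^ 2 := by positivity
  have hC0 : 0 < C := by linarith
  -- the `e_k`-small regime: all five conditions eventually
  obtain ⟨δ, hδ, hreg⟩ := exists_threshold (Q := fun x : ℝ =>
      ((n₀ : ℝ) + 1 ≤ 1 / (8 * v) * (81 / 100) * (1 : ℝ) ^ 2 * Real.log x⁻¹ ^ (2 * p - 1)) ∧ Real.exp 1 * x ≤ 1 ∧
        C ^ n₀ * 4 * x ≤ 1 ∧ 16 * x ≤ 1 ∧ x ≤ 1) (by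
    filter_upwards [eventually_const_le_mul_log_rpow ((n₀ : ℝ) + 1) _ (2 * p - 1) hκ0 (by linarith),
      eventually_const_mul_le_one (Real.exp 1), eventually_const_mul_le_one (C ^ n₀ * 4), eventually_const_mul_le_one 16,
      eventually_le_one] with x h1 h2 h3 h4 h5
    exact ⟨h1, h2, h3, h4, h5⟩)
  refine ⟨δ, hδ, ?_⟩
  intro e he heδ Λ X t ht L _ _ hL γ H X₁ hX₁
  obtain ⟨h1, h2, h3, h4, h5⟩ := hreg e he heδ
  have he1 : e ≤ Real.exp (-1) := by
    have hpos := Real.exp_pos 1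
    calc e = Real.exp 1 * e / Real.exp 1 := by field_simp
      _ ≤ 1 / Real.exp 1 := by gcongr
      _ = Real.exp (-1) := by rw [Real.exp_neg, one_div]
  have hsq1 : Real.sqrt e ≤ 1 := by rw [← Real.sqrt_one]; exact Real.sqrt_le_sqrt h5
  have hsqrt : e ≤ Real.sqrt e := by
    calc e = Real.sqrt e * Real.sqrt e := (Real.mul_self_sqrt he.le).symm
      _ ≤ Real.sqrt e * 1 := by gcongr
      _ = Real.sqrt e := mul_one _
  have hsq4 : Real.sqrt e ≤ 1 / 4 := by
    have h16 : e ≤ (1 / 4) ^ 2 := by nlinarith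
    calc Real.sqrt e ≤ Real.sqrt ((1 / 4) ^ 2) := Real.sqrt_le_sqrt h16
      _ = 1 / 4 := Real.sqrt_sq (by norm_num)
  -- the Gaussian tail of the slot field under the one-site law (mean `0` since `ℱ = 0`, variance `≤ v`)
  have hPD : (prec (fun _ : Unit => ()) (1 : Matrix Unit Unit ℝ) ({()} : Finset Unit) (corner ℝ ({()} : Finset Unit))).PosDef :=
    prec_corner_posDef (fun _ : Unit => ()) (1 : Matrix Unit Unit ℝ) Matrix.PosDef.one {()} {()}
  have hlin : IsLinearMap ℝ (fun φ : Unit → ℝ => φ ()) := (LinearMap.proj (R := ℝ) (φ := fun _ : Unit => ℝ) ()).isLinear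
  have hmean : |∫ ω, (fun φ : Unit → ℝ => φ ()) (ext (fun _ : Unit => ()) ({()} : Finset Unit) ω) ∂P₀| ≤ 0 := by
    rw [hP₀, BIJ88EffectiveActionGauss308.integral_slotField_fieldLaw (fun _ : Unit => ()) (1 : Matrix Unit Unit ℝ) (0 : Unit → ℝ) {()}
      (Φ := fun (_ : Unit) (φ : Unit → ℝ) => φ ()) hPD (b := ()) hlin,
      BIJ88EffectiveActionGauss308.slotField_meanField_eq_zero_of_zero (fun _ : Unit => ()) (1 : Matrix Unit Unit ℝ) {()}
      (Φ := fun (_ : Unit) (φ : Unit → ℝ) => φ ()) (b := ()) hlin, abs_zero]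
  have hvar : Var[fun ω => (fun φ : Unit → ℝ => φ ()) (ext (fun _ : Unit => ()) ({()} : Finset Unit) ω); P₀] ≤ v := by
    rw [hv]; exact le_add_of_nonneg_left zero_le_one
  have htail : ∀ (i : Unit) (b : ↥({()} : Finset Unit)), (fun _ : ↥({()} : Finset Unit) ⊕ ↥(∅ : Finset Unit) => ()) (Sum.inl b) = i →
      ∀ a : ℝ, 0 ≤ a → (fieldLaw (fun _ : Unit => ()) (1 : Matrix Unit Unit ℝ) (0 : Unit → ℝ) {i}).real
        {ω | a ≤ |(fun (_ : Unit) (φ : Unit → ℝ) => φ ()) b (ext (fun _ : Unit => ()) {i} ω)|} ≤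
          4 * Real.exp (0 ^ 2 / (2 * v)) * Real.exp (-(1 / (8 * v) * a ^ 2)) := by
    intro i b _ a ha
    exact BIJ88GaussShellModulus309.tail_slotField_fieldLaw_of_mod (fun _ : Unit => ()) (1 : Matrix Unit Unit ℝ) (0 : Unit → ℝ) {()} hPD
      hlin hlin (Or.inl fun _ => rfl) hmean hmean hv0 hvar hvar ha
  -- slots per cube: one
  have hG : ∀ i : Unit, (univ.filter fun τ : ↥({()} : Finset Unit) ⊕ ↥(∅ : Finset Unit) =>
      (fun _ : ↥({()} : Finset Unit) ⊕ ↥(∅ : Finset Unit) => ()) τ = i).card ≤ 1 := fun i =>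
    (card_le_univ _).trans (by simp)
  -- the regime inequalities in the shape of the theorem
  have hpre : C ^ n₀ * (4 * Real.exp (0 ^ 2 / (2 * v))) * Real.exp (((1 : ℕ) : ℝ) * 0) * e ≤ 1 := by
    have : C ^ n₀ * (4 * Real.exp (0 ^ 2 / (2 * v))) * Real.exp (((1 : ℕ) : ℝ) * 0) * e = C ^ n₀ * 4 * e := by simp
    rw [this]; exact h3
  have hvac : Real.exp (((1 : ℕ) : ℝ) * 0) * ((1 : ℕ) : ℝ) * (4 * Real.exp (0 ^ 2 / (2 * v))) * e + (Real.exp (((1 : ℕ) : ℝ) * 0) - 1) ≤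
      Real.sqrt e ^ (1 : ℝ) := by
    have : Real.exp (((1 : ℕ) : ℝ) * 0) * ((1 : ℕ) : ℝ) * (4 * Real.exp (0 ^ 2 / (2 * v))) * e + (Real.exp (((1 : ℕ) : ℝ) * 0) - 1) =
        4 * e := by simp
    rw [this, Real.rpow_one]
    calc 4 * e = (4 * Real.sqrt e) * Real.sqrt e := by rw [mul_assoc, Real.mul_self_sqrt he.le]
      _ ≤ 1 * Real.sqrt e := by gcongr; linarith
      _ = Real.sqrt e := one_mul _
  exact ineq5144_locAct_singleton_of_const (fun _ : Unit => ()) (1 : Matrix Unit Unit ℝ) (0 : Unit → ℝ) adj gevreyCutoff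
    (fun _ => ()) hp hC1 hC Matrix.PosDef.one (fun x => chi1_nonneg x) one_pos (fun _ _ => le_rfl)
    (fun _ _ => measurable_pi_apply _) (fun Y hY => absurd hY (by simp)) (KY := fun _ => 0) (fun Y hY => absurd hY (by simp))
    (K₁ := 0) le_rfl (fun Y hY => absurd hY (by simp)) (G := 1) hG (by positivity) (by positivity) htail he he1 (θ := Real.sqrt e)
    (β' := 1) hsqrt h1 hpre (fun Y hY => absurd hY (by simp)) hvac Λ X ht hL γ H X₁ hX₁

end Literature.MathematicalPhysics.QuantumFieldTheory.BalabanImbrieJaffe1984to88.BIJ88Ineq5144OneCubeInstance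

end
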